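import Summits.QuantumAdvantage.QuantumAdvantage.Theorems.CubicForrelationNearExactIsExactTenCensusCases

/-!
# Crux `CubicForrelation.NearExactIsExact` (stmt-QuantumAdvantage-14043): isolation at `θ = 7/8` on 10 bits —
  UNCONDITIONAL (the census hypothesis CENSUS₁₀′ discharged by proof)

Block-2b certificate seat `b2b-cforr-cert` (2026-08-18).  HONEST FRAMING: the value here is a THEOREM about the finite
slice `n = 10` of the crux `NearExactIsExact` — for all cubic `f, g : 𝔽₂¹⁰ → 𝔽₂`, `Φ(f,g) > 7/8 ⇒ Φ(f,g) = 1`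
(`isolation_ten_78`) — NOT summit progress.  What is proved at which `n` (all kernel-checked, standard axioms):
`θ = 7/8` for every even `n ≤ 8` (`isolation_eight`, `nearExact78_le_six`), `θ = 7/8` at `n = 10` (THIS FILE; tight:
`Φ = 7/8` is attained at `n = 10`, `forrelation_fT_gT`), `θ = 15/16` at `n = 12` (`isolation_twelve_15_16`), `31/32` at
`n = 14`, `63/64` at `n = 16`; and `Φ = 15/16 < 1` IS attained at `n = 16` (`Negative/FifteenSixteenths.lean`), so the
crux's global constant (if it exists) is `≥ 15/16` — `7/8` is the sharp constant at `n = 10` only.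

`census10_prime_false`: the hypothesis CENSUS₁₀′ of the lead's `isolation_ten_78_of_census2` (no `(E, D, Q, bh, f₁)` with
the heavy/light cell congruences and a cubic partner above `7/8`) HOLDS — proved here without any census: restrict the
partner `f₁` to the heavy hyperplane (a cubic `F₀` on 9 bits), compare the Fourier identity `p̂ = 32σ·1_{Q = bh}` of the
heavy quotient (`nf10_W_p`) with the 2-adic Walsh tower of `F₀` (`nf10_caseE`: `16 ∣ W_{F₀}` forces the heavy error to
vanish; `nf10_caseO`: type O forces it to be `−8η·δ_c`), and finish with the energy identity `Σp² = 4·#{Q = bh}`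
(`nf10_sum_p_sq`) against `Q` unbalanced resp. the quadratic bias values (`nf10_quad_bias_sq`).  The outside-Lean
censuses (kit j025070–4, j038490–5) are thereby superseded.  Axioms: the standard three.
-/

set_option linter.dupNamespace false -- D-0017: single-problem summit ⇒ `QuantumAdvantage.QuantumAdvantage` by design

noncomputable section

namespace Summit.QuantumAdvantage.QuantumAdvantage.Theorems.CubicForrelation.NearExactIsExact

open Finset
open Literature.Computability.QuantumComplexity
open Literature.Computability.QuantumComplexity.BuzetChailloux (signOf_sq)
open Literature.Computability.QuantumComplexity.DerivativeWalsh (W sum_W_sq)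

/-! ### The discharge of CENSUS₁₀′ and the unconditional `n = 10`, `θ = 7/8` isolation -/

/-- **CENSUS₁₀′ holds (by proof, no census).**  For every `E` (cubic), `D`, `Q` (quadratic) on 8 bits, `bh : Bool` and cubic
`f₁` on 10 bits: if `Q` is unbalanced, all heavy cell sums are `8·odd` and all light ones `4·odd`, then
`Φ(f₁, g_{E,D,Q}) ≤ 7/8`.  Proof: restrict `f₁` to the heavy hyperplane, run the 2-adic tower on this 9-bit cubic against
the Fourier identity `p̂ = 32σ1_{Q = bh}` (`nf10_caseE`, `nf10_caseO`), and finish with the energy identity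
`Σp² = 4·#{Q = bh}` and the quadratic bias values. [this work] -/
theorem census10_prime_false (E D Q : (Fin (4 + 4) → Bool) → Bool) (bh : Bool)
    (f₁ : (Fin (4 + 4 + 1 + 1) → Bool) → Bool)
    (_hE : IsDegLeFun 3 E) (_hD : IsDegLeFun 2 D) (hQ : IsDegLeFun 2 Q) (hf₁ : IsDegLeFun 3 f₁)
    (hQne : (∑ w, signOf (Q w)) ≠ 0)
    (hH : ∀ (a : Bool) (x : Fin (4 + 4) → Bool), ∃ k : ℤ,
      (∑ w : Fin (4 + 4) → Bool, if (D w = a ∧ Q w = bh) then signOf (E w) * twist w x else 0) = 8 * (2 * (k : ℝ) + 1))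
    (hL : ∀ (a : Bool) (x : Fin (4 + 4) → Bool), ∃ k : ℤ,
      (∑ w : Fin (4 + 4) → Bool, if (D w = a ∧ Q w = !bh) then signOf (E w) * twist w x else 0) = 4 * (2 * (k : ℝ) + 1))
    (hΦ : 7 / 8 < forrelation f₁ (fun y : Fin (4 + 4 + 1 + 1) → Bool =>
            E (fun i : Fin (4 + 4) => y (Fin.castLE (by omega) i)) ^^
              (y ⟨8, by norm_num⟩ && D (fun i : Fin (4 + 4) => y (Fin.castLE (by omega) i))) ^^
              (y ⟨9, by norm_num⟩ && Q (fun i : Fin (4 + 4) => y (Fin.castLE (by omega) i))))) : False := by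
  set g : (Fin (4 + 4 + 1 + 1) → Bool) → Bool := fun y =>
    E (fun i : Fin (4 + 4) => y (Fin.castLE (by omega) i)) ^^
      (y ⟨8, by norm_num⟩ && D (fun i : Fin (4 + 4) => y (Fin.castLE (by omega) i))) ^^
      (y ⟨9, by norm_num⟩ && Q (fun i : Fin (4 + 4) => y (Fin.castLE (by omega) i))) with hgdef
  have hshape : ∀ (w : Fin (4 + 4) → Bool) (a₀ b₀ : Bool),
      g (Fin.snoc (Fin.snoc w a₀) b₀) = (E w ^^ (a₀ && D w) ^^ (b₀ && (Q w ^^ false))) := by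
    intro w a₀ b₀
    have hw : (fun i : Fin (4 + 4) => (Fin.snoc (Fin.snoc w a₀) b₀ : Fin (4 + 4 + 1 + 1) → Bool)
        (Fin.castLE (by omega) i)) = w := by
      funext i
      rw [show (Fin.castLE (by omega) i : Fin (4 + 4 + 1 + 1)) = Fin.castSucc (Fin.castSucc i) from Fin.ext rfl,
        Fin.snoc_castSucc, Fin.snoc_castSucc]
    have h8 : (Fin.snoc (Fin.snoc w a₀) b₀ : Fin (4 + 4 + 1 + 1) → Bool) ⟨8, by norm_num⟩ = a₀ := by
      rw [show (⟨8, by norm_num⟩ : Fin (4 + 4 + 1 + 1)) = Fin.castSucc (Fin.last (4 + 4)) from Fin.ext rfl,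
        Fin.snoc_castSucc, Fin.snoc_last]
    have h9 : (Fin.snoc (Fin.snoc w a₀) b₀ : Fin (4 + 4 + 1 + 1) → Bool) ⟨9, by norm_num⟩ = b₀ := by
      rw [show (⟨9, by norm_num⟩ : Fin (4 + 4 + 1 + 1)) = Fin.last (4 + 4 + 1) from Fin.ext rfl, Fin.snoc_last]
    simp only [hgdef, hw, h8, h9, Bool.xor_false]
  -- the heavy and light quotients
  choose kH hkH using hH
  choose kL hkL using hL
  set p : (Fin (4 + 4 + 1) → Bool) → ℤ := fun z => 2 * kH (z (Fin.last _)) (Fin.init z) + 1 with hpdef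
  set v : (Fin (4 + 4 + 1) → Bool) → ℤ := fun z => 2 * kL (z (Fin.last _)) (Fin.init z) + 1 with hvdef
  have hp : ∀ (ξ : Fin (4 + 4) → Bool) (a : Bool),
      (∑ w : Fin (4 + 4) → Bool, if (D w = a ∧ Q w = bh) then signOf (E w) * twist w ξ else 0) =
        8 * (p (Fin.snoc ξ a) : ℝ) := fun ξ a => by
    rw [hkH a ξ]; simp only [hpdef, Fin.snoc_last, Fin.init_snoc]; push_cast; ring
  have hv : ∀ (ξ : Fin (4 + 4) → Bool) (a : Bool),
      (∑ w : Fin (4 + 4) → Bool, if (D w = a ∧ Q w = !bh) then signOf (E w) * twist w ξ else 0) =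
        4 * (v (Fin.snoc ξ a) : ℝ) := fun ξ a => by
    rw [hkL a ξ]; simp only [hvdef, Fin.snoc_last, Fin.init_snoc]; push_cast; ring
  have hvodd : ∀ z, Odd (v z) := fun z => ⟨_, rfl⟩
  have hpodd : ∀ z, Odd (p z) := fun z => ⟨_, rfl⟩
  have hWh := nf10_W_heavy E D Q bh g p hshape hp
  have hWl := nf10_W_light E D Q bh g v hshape hv
  have hbud := nf10_heavy_budget bh g p v f₁ hΦ hWh hWl hvodd
  -- the heavy error `e = p − s`
  set sZ : (Fin (4 + 4 + 1) → Bool) → ℤ := fun z => if f₁ (Fin.snoc z bh) then -1 else 1 with hsZ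
  have hsR : ∀ z, (sZ z : ℝ) = signOf (f₁ (Fin.snoc z bh)) := fun z => by
    cases h : f₁ (Fin.snoc z bh) <;> simp [hsZ, h, signOf]
  set e : (Fin (4 + 4 + 1) → Bool) → ℤ := fun z => p z - sZ z with hedef
  have heven : ∀ z, Even (e z) := fun z => by
    have : Odd (sZ z) := by cases h : f₁ (Fin.snoc z bh) <;> simp [hsZ, h]
    exact Int.even_sub'.2 (by simp [hpodd z, this])
  have hesq : ∑ z, ((e z : ℝ)) ^ 2 < 128 := by
    have : ∀ z, ((e z : ℝ)) = (p z : ℝ) - signOf (f₁ (Fin.snoc z bh)) := fun z => by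
      rw [hedef]; push_cast; rw [hsR]
    rw [sum_congr rfl fun z _ => by rw [this z]]; exact hbud
  -- the Fourier identity `ê = 32 C − W_{F₀}`
  set C : (Fin (4 + 4 + 1) → Bool) → ℤ := fun y =>
    if Q (Fin.init y) = bh then (if (E (Fin.init y) ^^ (y (Fin.last _) && D (Fin.init y))) then -1 else 1) else 0 with hCdef
  have hCR : ∀ y, (C y : ℝ) =
      (if Q (Fin.init y) = bh then signOf (E (Fin.init y) ^^ (y (Fin.last _) && D (Fin.init y))) else 0) := fun y => by
    simp only [hCdef]
    by_cases hq : Q (Fin.init y) = bh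
    · rw [if_pos hq, if_pos hq]
      cases (E (Fin.init y) ^^ (y (Fin.last (4 + 4)) && D (Fin.init y))) <;> simp [signOf]
    · rw [if_neg hq, if_neg hq]; simp
  have he : ∀ y, W (fun z => (e z : ℝ)) y = 32 * (C y : ℝ) - W (fun z => signOf (f₁ (Fin.snoc z bh))) y := by
    intro y
    have h1 := nf10_W_p E D Q bh p hp y
    rw [hCR, ← h1]
    unfold W
    rw [← sum_sub_distrib]
    exact sum_congr rfl fun z _ => by rw [hedef]; push_cast; rw [hsR]; ring
  -- `[C odd] = [Q(init y) = bh]` has degree ≤ 2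
  have hQinit : IsDegLeFun 2 (fun y : Fin (4 + 4 + 1) → Bool => Q (Fin.init y)) :=
    nf_isDegLeFun_subst (fun i => MvPolynomial.X (Fin.castSucc i))
      (fun i => (MvPolynomial.totalDegree_X _).le) (fun y => Fin.init y)
      (fun y i => by simp only [MvPolynomial.eval_X]; rfl) hQ
  have hCdeg : IsDegLeFun 3 (fun y => decide (Odd (C y))) := by
    refine rm_isDegLeFun_congr (((tb_isDegLeFun_xor_const hQinit bh).not).mono (by norm_num)) fun y => ?_
    by_cases hq : Q (Fin.init y) = bh
    · have hC : C y = 1 ∨ C y = -1 := by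
        simp only [hCdef, hq, if_true]
        cases (E (Fin.init y) ^^ (y (Fin.last (4 + 4)) && D (Fin.init y))) <;> simp
      have h1 : (!(Q (Fin.init y) ^^ bh)) = true := by rw [hq]; cases bh <;> rfl
      rw [h1]; symm; rw [decide_eq_true_eq]
      rcases hC with h | h <;> rw [h] <;> decide
    · have hC : C y = 0 := by simp [hCdef, hq]
      have h1 : (!(Q (Fin.init y) ^^ bh)) = false := by
        cases hQ' : Q (Fin.init y) <;> cases hb : bh <;> simp_all
      rw [h1]; symm; rw [decide_eq_false_iff_not, hC]; decide
  -- Ax: `W_{F₀} = 8 uF`, and the level-3 parity is constant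
  have hF₀ : IsDegLeFun 3 (fun z : Fin (4 + 4 + 1) → Bool => f₁ (Fin.snoc z bh)) := tb_isDegLeFun_snoc (F := f₁) hf₁ bh
  have hgran := vg_W_granular stub_axParity (fun z : Fin (4 + 4 + 1) → Bool => f₁ (Fin.snoc z bh)) hF₀
  choose uF huF using hgran
  have huF3 : ∀ y, W (fun z => signOf (f₁ (Fin.snoc z bh))) y = (2 : ℝ) ^ 3 * (uF y : ℝ) := fun y => by
    rw [huF y]
  have hdeg0 : IsDegLeFun 0 (fun y => decide (Odd (uF y))) :=
    stub_walshTower stub_axParity (4 + 4 + 1) 3 0 _ uF hF₀ huF3 (fun k hk hk9 => by omega)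
  -- energy identity for `p`
  have hEn := nf10_sum_p_sq E D Q bh p hp
  have hSQ := nf10_sum_signOf_Q Q bh
  have hbias := nf10_quad_bias_sq Q hQ
  by_cases hO : ∃ y, decide (Odd (uF y)) = true
  · -- Case O
    obtain ⟨y₀, hy₀⟩ := hO
    have hall := nf10_all_of_deg_zero hdeg0 hy₀
    have hodd : ∀ y, Odd (uF y) := fun y => by simpa using hall y
    obtain ⟨c, η, hη1, hec, hez⟩ := nf10_caseO f₁ bh hf₁ e C uF huF3 hodd he hCdeg hesq heven
    -- `Σ p² = 511 + (s c − 8η)²`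
    have hpc : p c = sZ c - 8 * η := by have := hec; rw [hedef] at this; simp only at this; linarith
    have hpz : ∀ z, z ≠ c → p z = sZ z := fun z hz => by have := hez z hz; rw [hedef] at this; simp only at this; linarith
    have hs1 : ∀ z, sZ z = 1 ∨ sZ z = -1 := fun z => by cases h : f₁ (Fin.snoc z bh) <;> simp [hsZ, h]
    have h511 : ∑ z ∈ univ.erase c, (1 : ℝ) = 511 := by
      rw [sum_erase_eq_sub (mem_univ c), sum_const, card_univ]
      simp only [Fintype.card_fun, Fintype.card_bool, Fintype.card_fin]
      norm_num
    have hsum : ∑ z, ((p z : ℝ)) ^ 2 = 511 + ((sZ c : ℝ) - 8 * η) ^ 2 := by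
      have h2 : ∑ z ∈ univ.erase c, ((p z : ℝ)) ^ 2 = ∑ z ∈ univ.erase c, (1 : ℝ) := by
        refine sum_congr rfl fun z hz => ?_
        rw [hpz z (mem_erase.1 hz).1]
        rcases hs1 z with h | h <;> simp [h]
      rw [nf10_sum_split _ c, h2, h511]
      have : ((p c : ℝ)) = (sZ c : ℝ) - 8 * η := by rw [hpc]; push_cast; ring
      rw [this]; ring
    -- so `#{Q = bh} ∈ {140, 148}` and `(Σ (−1)^Q)² ∈ {576, 1600}`
    rw [hEn] at hsum
    have hsb : signOf bh ^ 2 = (1 : ℝ) := signOf_sq bh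
    have hsq : ((sZ c : ℝ) - 8 * η) ^ 2 = 49 ∨ ((sZ c : ℝ) - 8 * η) ^ 2 = 81 := by
      rcases hs1 c with h | h <;> rcases hη1 with h' | h' <;>
        · rw [show (sZ c : ℝ) = ((sZ c : ℤ) : ℝ) from rfl, h, h']; norm_num
    rcases hsq with h49 | h81
    · rw [h49] at hsum
      have hN : ∑ w : Fin (4 + 4) → Bool, (if Q w = bh then (1 : ℝ) else 0) = 140 := by linarith
      refine hbias.1 ?_
      rw [hSQ, hN, mul_pow, hsb]; norm_num
    · rw [h81] at hsum
      have hN : ∑ w : Fin (4 + 4) → Bool, (if Q w = bh then (1 : ℝ) else 0) = 148 := by linarith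
      refine hbias.2 ?_
      rw [hSQ, hN, mul_pow, hsb]; norm_num
  · -- Case E
    push Not at hO
    have hE' : ∀ y, ∃ m : ℤ, uF y = 2 * m := fun y => by
      have h : ¬ Odd (uF y) := by simpa using hO y
      obtain ⟨m, hm⟩ := Int.not_odd_iff_even.1 h
      exact ⟨m, by omega⟩
    choose u₄ hu₄ using hE'
    have hW4 : ∀ y, W (fun z => signOf (f₁ (Fin.snoc z bh))) y = (2 : ℝ) ^ 4 * (u₄ y : ℝ) := fun y => by
      rw [huF y, hu₄ y]; push_cast; ring
    have hz := nf10_caseE f₁ bh hf₁ e C u₄ hW4 he hCdeg hesq heven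
    -- `p = s`, so `Σ p² = 512`, `#{Q = bh} = 128`, `Σ (−1)^Q = 0`
    have hps : ∀ z, p z = sZ z := fun z => by have := hz z; rw [hedef] at this; simp only at this; linarith
    have hs1 : ∀ z, sZ z = 1 ∨ sZ z = -1 := fun z => by cases h : f₁ (Fin.snoc z bh) <;> simp [hsZ, h]
    have hsum : ∑ z, ((p z : ℝ)) ^ 2 = 512 := by
      rw [sum_congr rfl fun z _ => show ((p z : ℝ)) ^ 2 = 1 by rw [hps z]; rcases hs1 z with h | h <;> simp [h]]
      simp
    rw [hEn] at hsum
    apply hQne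
    have hN : ∑ w : Fin (4 + 4) → Bool, (if Q w = bh then (1 : ℝ) else 0) = 128 := by linarith
    rw [hSQ, hN]; ring

/-- **Isolation at `θ = 7/8` on 10 bits — UNCONDITIONAL.**  For all cubic `f, g : 𝔽₂¹⁰ → 𝔽₂`,
`Φ(f,g) > 7/8 ⇒ Φ(f,g) = 1`.  This DISCHARGES the census hypothesis CENSUS₁₀′ of `isolation_ten_78_of_census2`
(lead c6) by proof (`census10_prime_false`); `7/8` is attained at `n = 10` (`forrelation_fT_gT`), so `7/8` is the exact
isolation threshold on 10 bits.  It is NOT the crux's global constant: `Φ = 15/16 < 1` occurs at `n = 16`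
(`Negative/FifteenSixteenths.lean`).  Value: a theorem about the finite slice `n = 10`, not summit progress. [this work] -/
theorem isolation_ten_78 :
    ∀ f g : (Fin (4 + 4 + 1 + 1) → Bool) → Bool, IsDegLeFun 3 f → IsDegLeFun 3 g →
      7 / 8 < forrelation f g → forrelation f g = 1 :=
  isolation_ten_78_of_census2 fun E D Q bh f₁ hE hD hQ hf₁ hQne _ hH hL hΦ =>
    census10_prime_false E D Q bh f₁ hE hD hQ hf₁ hQne hH hL hΦ

end Summit.QuantumAdvantage.QuantumAdvantage.Theorems.CubicForrelation.NearExactIsExact
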